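import Summits.AtomisticToContinuum.Crystallization.Theorems.ChargedEnergyGapDominoLedger
import HarnessLib

/-!
# ChargedEnergyGap (stmt-AtomisticToContinuum-14231) · NODE 89 «DominoLedger» — the κ-WINDOW LETTER as a SURGICAL K-EDITION
# (lens-3 g89 letter e1bd858a ADOPTED by critic row 1586; route (R-i′) of critic row 1590; executed by decomp-a2c hand-2 g42)

The gate's append-only rule forbids editing the landed `domCap` body in place («deprecate-and-add under a new name»), so the adopted letter arrives as
K-TWINS: `domKappa` (the shallow gain) + `domCapK` (= the `domCap` body of edition e1bd858a VERBATIM, i.e. both sub-plateau letters scaled by `domKappa d`) and,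
for EXACTLY the dependency closure of `domCap` in the landed g88 chain `…DominoLedgerA/B/…DominoLedger` (defs whose bodies reach the cap, theorems whose
STATEMENTS mention one of those), a twin with the short name suffixed `K` and the body BYTE-IDENTICAL modulo the K suffixes (licensed: no proof unfolds the cap,
lens-3 ScratchR90kappa rc 0).  Closure (computed; = the critic's desk pass): A — `domRank`, `domRank_injective`, `IsDominant`, `domLoad`, `domMoment`, `DominoLawQ'`,
`DominoMatchingQ'`; B — `dl_marked_le_dominant`, `dl_ballLoad_le_domLoad`, `dl_ballMoment_le_domMoment`, `ballMatchingSingleQ'_of_dominoLedger`; main —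
`ballMatchingSingleQ'_designate_of_dominoLedger`, `thawSplit_leaves_of_dominoLedger_leaves`, `chargedEnergyGap_of_dominoLedger_numerics`.  Every cap-INDEPENDENT
declaration (`holeCost`, `tiltSext`, `chargeDepth`, `domKey`, `SameDomino`, `ballRest`, `ballLine`, `domSum`, `dl_ballLoad_eq_rest_add_line`, `dl_marked_finite`,
`dl_ballLine_le_marked`, …) is NOT re-declared and is used from the g88 files.  The g88 `domCap` chain stays landed as the DEPRECATED edition: its (DL)/(D²) binder is
desk-violated on the shallow window `d̃ ≈ 101–107` at the g88 cap (lens-3 FINDING «PAIR-WINDOW-90», census DT46 §DL), superseded by this edition (critic rows 1586/1590).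
NODE 90 «FeetLaw» lands directly in K form on top of this file (`…ChargedEnergyGapFeetLawA` / `…FeetLaw`).

WHY κ (docstring of `domCapK`): two diagonally adjacent two-axis holes at `d̃ ≈ 103.4` cost `1.109 c_T > 1.080 c_T` = the g88 cap; `κ = 2` on `d ≤ 110` (ramp to `1`
at `113`) halves every observed shallow witness, leaves the binding (DT) cell `118.1` and the plateau untouched, (DT) price on `L ≤ 113` stays `≥ 1.71`.
Same namespace as the g88 chain; `noncomputable section`; 0 sorry; standard axioms; no instances / notation / options.  `--supports stmt-AtomisticToContinuum-14231`.
-/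

noncomputable section

open scoped Classical
open Literature.MathematicalPhysics.StatisticalMechanics Literature.Geometry.DiscreteGeometry
open Summit.AtomisticToContinuum.Crystallization.Theses.PricedLinkCensus
open Summit.AtomisticToContinuum.Crystallization.Theorems.ChargedEnergyGapNegative

namespace Summit.AtomisticToContinuum.Crystallization.Theorems.ChargedEnergyGapChartDial

/-! ## §K1. The κ cap and the cap-dependent domino calculus (twins of `…DominoLedgerA` §DominoCalculus) -/

section DominoCalculusK

/-- ★ The **SHALLOW GAIN** `κ(d) := max 1 (min 2 ((116 − d)/3))` of the cap edition R90κ (see `domCapK`): `2` on `d ≤ 110`, `1` on `d ≥ 113`, affine between.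
(The g88 docstring of the cap, kept for the record: the g88 DOMINO CAP `Ĉ(d) := unit/10 + max (103/100 · (τ·2ρ)² · roofVal T75 (tilted two-foot sextuple at d)) (45·unit · 𝟙[241/2 ≤ d])`
— a function of ONE depth (no kink, no phase, no table).  In units of `c_T` (`ρ = .687`, `ϱ = 160`): the two-foot letter
`1.03 × {0.17 (100), 2.83 (106), 10.44 (110), 26.2 (114), 35.7 (116), 43.4 (118.1), 44.8 (119.2, peak), 44.1 (120), 42.5 (120.5)}`; the
PLATEAU letter `45` from `d = 120.5` to the activity limit `d < 130.7` covers the junction (two-axis, "cross") holes of point-like obstacles, whose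
cost `≈ 39–41` on `[120.5, 123]` does not decay with the slab's (`36.9 (124)`, `24.5 (126)`, `16.9 (127)`, `3.9 (128)`, `0 (≥ 128.5)`), and
under which the slab budget is fat (`B(L) ≥ 57`).  Adversary slack: `3.1 %` on the bulk, `≥ 9 %` on the plateau (RESULTS-g88 §E–§G).) -/
def domKappa (d : ℝ) : ℝ :=
  max 1 (min 2 ((116 - d) / 3))

/-- ★★ The **DOMINO CAP** (edition R90κ, lens-3 g89 — the pre-registered «κ-WINDOW LETTER» repair of the g88 cap after FINDING «PAIR-WINDOW-90»):
`Ĉ(d) := κ(d)·unit/10 + max (κ(d)·103/100·(τ·2ρ)²·roofVal T75 (tilted two-foot sextuple at d)) (45·unit·𝟙[241/2 ≤ d])` with the SHALLOW GAIN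
`κ(d) = domKappa d = max 1 (min 2 ((116 − d)/3))` (`= 2` for `d ≤ 110`, linear to `1` at `d = 113`, `1` above — so `Ĉ` is the g88 cap VERBATIM for `d ≥ 113`:
the binding (DT) cell `118.1` (margin `1.081`) and the plateau are untouched).  WHY: two DIAGONALLY ADJACENT two-axis («junction-type») holes of a 6-foot
obstacle at sheet depth `d̃ ≈ 103.4` cost `0.714 + 0.395 = 1.109 c_T > 1.080 c_T` = the g88 cap (desk pair ratio `1.026`, RESULTS-g89 §D; closed-form 45° tents
reach `0.79`); with `κ = 2` on the window the two-hole law there is a COROLLARY of the single-hole law (pair ≤ 2 × single cap = `Ĉ`), and the adversarial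
pair ratio is `≤ 0.50` everywhere (RESULTS-g89 §F).  (DT) PRICE (aligned slab, phase 0, exact desk budget): `B/Ĉ = 3.35 (108) · 1.86 (110) · 1.72 (111) ·
1.71 (112) · 1.86 (113)`, unchanged `≥ 113` — all `≥ 1.08`; to be re-priced by the census over all phases / families for `L ≤ 113`. -/
def domCapK (unit ϱ τ ρ d : ℝ) : ℝ :=
  domKappa d * (unit / 10) +
    max (domKappa d * (103 / 100 * ((τ * (2 * ρ)) ^ 2 * roofVal T75 (tiltSext ϱ ρ d)))) (if (241 / 2 : ℝ) ≤ d then 45 * unit else 0)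

/-- The **DOMINO RANK** of a hole: (cap at its sheet depth, the hole) in the lexicographic order — the dominant hole of a domino is the rank-maximal
marked one (largest cap, ties broken by the lattice point). -/
def domRankK (unit ϱ τ ρ : ℝ) (d : (Fin 3 → ℤ) → ℝ) (w : Fin 3 → ℤ) : Lex (ℝ × Lex (Fin 3 → ℤ)) :=
  toLex (domCapK unit ϱ τ ρ (chargeDepth ρ d w), toLex w)

/-- `domRank_injectiveK` (docstring added by the landing lane; see the module docstring). [formal bookkeeping] -/
theorem domRank_injectiveK (unit ϱ τ ρ : ℝ) (d : (Fin 3 → ℤ) → ℝ) : Function.Injective (domRankK unit ϱ τ ρ d) := by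
  intro w w' h
  unfold domRankK at h
  exact toLex.injective (Prod.ext_iff.1 (toLex.injective h)).2

/-- ★ **DOMINANT HOLE** (for the marking predicate `mk` and the depth field `d`): marked, and rank-maximal among the marked holes of its domino.
Every domino with a marked hole has exactly one (`dl_marked_le_dominantK`). -/
def IsDominantK (unit ϱ τ ρ : ℝ) (d : (Fin 3 → ℤ) → ℝ) (mk : (Fin 3 → ℤ) → Prop) (w : Fin 3 → ℤ) : Prop :=
  mk w ∧ ∀ w', mk w' → SameDomino ρ d w w' → domRankK unit ϱ τ ρ d w' ≤ domRankK unit ϱ τ ρ d w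

end DominoCalculusK

/-! ## §K2. Dominant load and moment (twins of `…DominoLedgerA` §DominoLoad) -/

section DominoLoadK

variable (ϱχ : ℝ) {m : ℕ} (D : Fin m → Set E3) (σ : Fin m → Bool)

/-- ★★ The **DOMINO LOAD** at `x`: the thawed rest load plus `Ĉ(sheet depth)` ONCE per domino with a hole marked at `x` (at its dominant hole). -/
def domLoadK (R_N unit r_f dK dstar κ c_T cχ : ℝ) (P : PeriodicConfiguration 3) (C X : Set E3) (τ ϱ r₁ r₂ : ℝ) (c₀ : E3) (f : Fin 3 → E3)
    (ρ : ℝ) (x : E3) : ℝ :=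
  ballRest ϱχ D σ R_N r_f dK dstar κ c_T cχ P C X τ ϱ r₁ r₂ x +
    ∑ᶠ w : Fin 3 → ℤ,
      if IsDominantK unit ϱ τ ρ (latDepth C c₀ f ρ) (IsMarked ϱχ D σ R_N r_f dK dstar κ c_T cχ P C X τ ϱ r₁ r₂ c₀ f ρ x) w then
        domCapK unit ϱ τ ρ (chargeDepth ρ (latDepth C c₀ f ρ) w)
      else 0

/-- ★★ The **DOMINO MOMENT** `Ξ_D(y) := Σ_x pool(x) · domLoadK(x)` over the reference sites `x` with `dist x y ≤ R_N` — `ballMoment` of NODE 79/80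
with `ballLoad ↦ domLoadK`: PHASE-FREE, KINK-FREE, TABLE-FREE. -/
def domMomentK (R_N unit r_f dK dstar κ c_T cχ : ℝ) (P : PeriodicConfiguration 3) (C X : Set E3) (τ ϱ r₁ r₂ : ℝ) (c₀ : E3) (f : Fin 3 → E3)
    (ρ : ℝ) (y : E3) : ℝ :=
  ∑ᶠ x : E3,
    if x ∈ P.points ∧ dist x y ≤ R_N then
      pool ϱχ D σ r_f dK dstar κ c_T cχ P C X τ ϱ r₁ r₂ x * domLoadK ϱχ D σ R_N unit r_f dK dstar κ c_T cχ P C X τ ϱ r₁ r₂ c₀ f ρ x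
    else 0

end DominoLoadK

/-! ## §K3. The laws (DL)/(DM) at the κ cap (twins of `…DominoLedgerA` §Pieces89) -/

section Pieces89K

/-- ★★★ **(DL) THE DOMINO LAW** — for every reference of the class with a cubic frame `(c₀, f, ρ₀)`, every HEAVY ACTIVE CREASED ordered mid pair
`(y, z)` whose ball is SINGLE-CROSSING, every site `x` of the ball and every DOMINANT marked hole `w` at `x`: the thawed hole costs of the holes
marked at `x` on the domino of `w` sum to at most `Ĉ(sheet depth of w)`.
[LOCAL · TWO-HOLE (single crossing ⇒ ≤ 1 marked hole per line ⇒ ≤ 2 per domino) · RESIDUAL (conjecture; desk ADVERSARY (pattern search over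
≤ 6-point obstacles + planes): bulk supremum = tilted two-foot obstacle `0.969 Ĉ`, aligned slab `0.945`, dihedral creases `≤ .92`, tilted planes
`≤ .89`, crease-end / Y-junction partners `0`, oblate ring `.83`, random point clouds `≤ .89`; plateau: junction holes `≤ 0.91 Ĉ`) · UNDECIDED(test:
seven-point LP adversary census of `domSum/Ĉ`) · ATTACKABLE-L ([ALIGNED-EXTREMAL] as a two-hole extremal problem over ≤ 14 feet of the cut set) ·
INSTRUMENTABLE · why it might fail: a cut set realising at the ≤ 2 marked holes of one domino six-depth patterns beating `1.03 ×` the tilted two-foot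
cost (bulk) or `45 c_T` (plateau `d̃ ≥ 120.5`) · strictly weaker than (M¹) in content: no pool, no matching, ≤ 2 holes; does not imply (M¹)] -/
def DominoLawQ'K (cls : Set E3 → Prop) (R_N r_f dK dstar κ c_T cχ unit : ℝ) (s lam ℓ τ ϱ ϱχ r₁ r₂ ρlo ρhi : ℝ) : Prop :=
  ∀ (P : PeriodicConfiguration 3) (C X : Set E3) (m : ℕ) (D : Fin m → Set E3) (σ : Fin m → Bool),
    IsSeparatedRef s P → IsLabelledRef lam ℓ P → cls P.points → IsForceFree P → IsSiteStressFree P →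
    IsInvariantSet P C → IsInvariantSet P X → (∀ i, IsInvariantSet P (D i)) → (∀ i, IsConvexPieces (2 * ϱχ) (D i)) →
    IsFramedOct P r₁ r₂ ρlo ρhi →
    ∀ (c₀ : E3) (f : Fin 3 → E3) (ρ₀ : ℝ), Orthonormal ℝ f → ρlo ≤ ρ₀ → ρ₀ ≤ ρhi → IsCubicFrameOf P r₁ r₂ c₀ f ρ₀ →
    ∀ y z : E3, HeavyActive ϱχ D σ r_f dK dstar κ c_T cχ P C X τ ϱ r₁ r₂ y z → ¬OctTame r_f C P r₁ y z →
      IsSingleCrossingBall ϱχ D σ R_N r_f dK dstar κ c_T cχ P C X τ ϱ r₁ r₂ c₀ f ρ₀ y →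
      ∀ x : E3, x ∈ P.points → dist x y ≤ R_N → ∀ w : Fin 3 → ℤ,
        IsDominantK unit ϱ τ ρ₀ (latDepth C c₀ f ρ₀) (IsMarked ϱχ D σ R_N r_f dK dstar κ c_T cχ P C X τ ϱ r₁ r₂ c₀ f ρ₀ x) w →
        domSum ϱχ D σ R_N r_f dK dstar κ c_T cχ P C X τ ϱ r₁ r₂ c₀ f ρ₀ x w ≤ domCapK unit ϱ τ ρ₀ (chargeDepth ρ₀ (latDepth C c₀ f ρ₀) w)

/-- ★★★ **(DT) THE DOMINO MATCHING** — (M¹) `BallMatchingSingleQ'` VERBATIM with the true ball moment replaced by the DOMINO MOMENT `domMomentK`: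
for every reference of the class with a cubic frame and every heavy active creased ordered mid pair `(y, z)` whose ball is single-crossing,
`0 < Π(y)` and `Ξ_D(y) ≤ Π(y)²`.
[RESIDUAL-DECIDING · SUFFICIENT jointly with (DL) (glue `ballMatchingSingleQ'_of_dominoLedgerK`) · UNDECIDED(test: census of `Ξ_D/Π²`; est. margin
`1.081` = `B(L)/Ĉ(L)` at the binding slab `L ≈ 118.1`, UNIFORM in the comb phase; `≥ 1.10` off `L ∈ (117.2, 119.2)`; tilted sheets `≈ 1.081/cos θ`
(domino count ∝ cos θ, cap charged regardless of the true cost); bipolar discs and junction lines fat by counting) ·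
INSTRUMENTABLE (a lattice count with a one-variable cap) · ATTACKABLE-L · why it might fail: a single-crossing geometry with more charged dominoes per
unit pool than the slab (several marked families in one ball, each charged the full `Ĉ`) · strictly weaker than (M¹) in content: an explicit phase-free
majorant count; does not imply (M¹) without (DL)] -/
def DominoMatchingQ'K (cls : Set E3 → Prop) (R_N r_f dK dstar κ c_T cχ unit : ℝ) (s lam ℓ τ ϱ ϱχ r₁ r₂ ρlo ρhi : ℝ) : Prop :=
  ∀ (P : PeriodicConfiguration 3) (C X : Set E3) (m : ℕ) (D : Fin m → Set E3) (σ : Fin m → Bool),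
    IsSeparatedRef s P → IsLabelledRef lam ℓ P → cls P.points → IsForceFree P → IsSiteStressFree P →
    IsInvariantSet P C → IsInvariantSet P X → (∀ i, IsInvariantSet P (D i)) → (∀ i, IsConvexPieces (2 * ϱχ) (D i)) →
    IsFramedOct P r₁ r₂ ρlo ρhi →
    ∀ (c₀ : E3) (f : Fin 3 → E3) (ρ₀ : ℝ), Orthonormal ℝ f → ρlo ≤ ρ₀ → ρ₀ ≤ ρhi → IsCubicFrameOf P r₁ r₂ c₀ f ρ₀ →
    ∀ y z : E3, HeavyActive ϱχ D σ r_f dK dstar κ c_T cχ P C X τ ϱ r₁ r₂ y z → ¬OctTame r_f C P r₁ y z →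
      IsSingleCrossingBall ϱχ D σ R_N r_f dK dstar κ c_T cχ P C X τ ϱ r₁ r₂ c₀ f ρ₀ y →
      0 < ballPool ϱχ D σ R_N r_f dK dstar κ c_T cχ P C X τ ϱ r₁ r₂ y ∧
        domMomentK ϱχ D σ R_N unit r_f dK dstar κ c_T cχ P C X τ ϱ r₁ r₂ c₀ f ρ₀ y ≤
          ballPool ϱχ D σ R_N r_f dK dstar κ c_T cχ P C X τ ϱ r₁ r₂ y ^ 2

end Pieces89K

/-! ## §K4. Glue (twins of the cap-dependent part of `…DominoLedgerB`) -/

section Glue89K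

variable {ϱχ : ℝ} {m : ℕ} {D : Fin m → Set E3} {σ : Fin m → Bool}

/-- ★★ **DOMINO REGROUPING (PROVED)**: if the marked set is finite, hole charges are non-negative and every DOMINANT marked hole's domino sum is at
most its cap, then the total marked charge is at most the sum of the caps of the dominant holes — every domino class of a finite marked set has a
unique rank-maximal marked hole, which is dominant, and the classes partition the marked set.  Pure combinatorics (any `mk`, `d`, `hc`). -/
theorem dl_marked_le_dominantK {unit ϱ τ ρ : ℝ} {d : (Fin 3 → ℤ) → ℝ} {mk : (Fin 3 → ℤ) → Prop} {hc : (Fin 3 → ℤ) → ℝ}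
    (hfin : Set.Finite {w | mk w}) (hc0 : ∀ w, 0 ≤ hc w)
    (hlaw : ∀ w, IsDominantK unit ϱ τ ρ d mk w →
      ∑ᶠ w', (if mk w' ∧ SameDomino ρ d w w' then hc w' else 0) ≤ domCapK unit ϱ τ ρ (chargeDepth ρ d w)) :
    ∑ᶠ w, (if mk w then hc w else 0) ≤ ∑ᶠ w, (if IsDominantK unit ϱ τ ρ d mk w then domCapK unit ϱ τ ρ (chargeDepth ρ d w) else 0) := by
  set t := hfin.toFinset with ht
  have ht_mem : ∀ w, w ∈ t ↔ mk w := fun w => by rw [ht, Set.Finite.mem_toFinset, Set.mem_setOf_eq]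
  set R := domRankK unit ϱ τ ρ d with hR
  set cap : (Fin 3 → ℤ) → ℝ := fun w => domCapK unit ϱ τ ρ (chargeDepth ρ d w) with hcap
  -- the representative of a marked hole: the rank-maximal marked hole of its domino
  have hne : ∀ w ∈ t, (t.filter fun w' => SameDomino ρ d w w').Nonempty :=
    fun w hw => ⟨w, Finset.mem_filter.2 ⟨hw, sameDomino_refl ρ d w⟩⟩
  let rep : (Fin 3 → ℤ) → (Fin 3 → ℤ) := fun w =>
    if hw : w ∈ t then Classical.choose (Finset.exists_max_image _ R (hne w hw)) else w
  have hrep : ∀ w ∈ t, rep w ∈ t ∧ SameDomino ρ d w (rep w) ∧ ∀ w' ∈ t, SameDomino ρ d w w' → R w' ≤ R (rep w) := by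
    intro w hw
    have hsp := Classical.choose_spec (Finset.exists_max_image _ R (hne w hw))
    have he : rep w = Classical.choose (Finset.exists_max_image _ R (hne w hw)) := dif_pos hw
    rw [he]
    obtain ⟨hm, hmax⟩ := hsp
    rw [Finset.mem_filter] at hm
    exact ⟨hm.1, hm.2, fun w' hw' hsd => hmax w' (Finset.mem_filter.2 ⟨hw', hsd⟩)⟩
  -- representatives are dominant
  have hdom : ∀ w ∈ t, IsDominantK unit ϱ τ ρ d mk (rep w) := by
    intro w hw
    obtain ⟨hrt, hsd, hmax⟩ := hrep w hw
    exact ⟨(ht_mem _).1 hrt, fun w' hw' hsd' => hmax w' ((ht_mem _).2 hw') (hsd.trans hsd')⟩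
  -- a dominant hole is its own representative
  have hfix : ∀ w, IsDominantK unit ϱ τ ρ d mk w → w ∈ t ∧ rep w = w := by
    rintro w ⟨hw, hmax⟩
    have hwt := (ht_mem w).2 hw
    obtain ⟨hrt, hsd, hmax'⟩ := hrep w hwt
    refine ⟨hwt, domRank_injectiveK unit ϱ τ ρ d (le_antisymm ?_ ?_)⟩
    · exact hmax (rep w) ((ht_mem _).1 hrt) hsd
    · exact hmax' w hwt (sameDomino_refl ρ d w)
  -- the left side is a finite sum, fibrewise by representative
  have hL : ∑ᶠ w, (if mk w then hc w else 0) = ∑ w ∈ t, hc w := by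
    rw [finsum_eq_sum_of_support_subset _ (show (Function.support fun w => if mk w then hc w else 0) ⊆ ↑t from ?_)]
    · exact Finset.sum_congr rfl fun w hw => if_pos ((ht_mem w).1 hw)
    · intro w hw
      rw [Function.mem_support] at hw
      rw [Finset.mem_coe, ht_mem]
      by_contra hc'
      exact hw (if_neg hc')
  set u := t.image rep with hu
  have hfib : ∑ w ∈ t, hc w = ∑ r ∈ u, ∑ w ∈ t with rep w = r, hc w :=
    (Finset.sum_fiberwise_of_maps_to (fun w hw => Finset.mem_image_of_mem rep hw) hc).symm
  -- each fibre lies in the domino of its (dominant) representative: bounded by the law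
  have hfib_le : ∀ r ∈ u, ∑ w ∈ t with rep w = r, hc w ≤ cap r := by
    intro r hr
    rw [hu, Finset.mem_image] at hr
    obtain ⟨w₀, hw₀, hrw⟩ := hr
    have hdr : IsDominantK unit ϱ τ ρ d mk r := hrw ▸ hdom w₀ hw₀
    have hsub : (t.filter fun w => rep w = r) ⊆ t.filter fun w' => SameDomino ρ d r w' := by
      intro w hw
      rw [Finset.mem_filter] at hw ⊢
      obtain ⟨hwt, hwr⟩ := hw
      have hsd := (hrep w hwt).2.1
      rw [hwr] at hsd
      exact ⟨hwt, hsd.symm⟩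
    have hsum : ∑ᶠ w', (if mk w' ∧ SameDomino ρ d r w' then hc w' else 0) =
        ∑ w' ∈ t.filter (fun w' => SameDomino ρ d r w'), hc w' := by
      rw [finsum_eq_sum_of_support_subset _ (show (Function.support fun w' => if mk w' ∧ SameDomino ρ d r w' then hc w' else 0) ⊆
          ↑(t.filter fun w' => SameDomino ρ d r w') from ?_)]
      · refine Finset.sum_congr rfl fun w' hw' => ?_
        rw [Finset.mem_filter] at hw'
        exact if_pos ⟨(ht_mem _).1 hw'.1, hw'.2⟩
      · intro w' hw'
        rw [Function.mem_support] at hw'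
        rw [Finset.mem_coe, Finset.mem_filter, ht_mem]
        by_contra hc'
        exact hw' (if_neg hc')
    calc ∑ w ∈ t with rep w = r, hc w ≤ ∑ w' ∈ t.filter (fun w' => SameDomino ρ d r w'), hc w' :=
          Finset.sum_le_sum_of_subset_of_nonneg hsub fun w _ _ => hc0 w
      _ = ∑ᶠ w', (if mk w' ∧ SameDomino ρ d r w' then hc w' else 0) := hsum.symm
      _ ≤ cap r := hlaw r hdr
  -- the right side is the sum of the caps over the representatives
  have hRHS : ∑ᶠ w, (if IsDominantK unit ϱ τ ρ d mk w then cap w else 0) = ∑ r ∈ u, cap r := by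
    rw [finsum_eq_sum_of_support_subset _ (show (Function.support fun w => if IsDominantK unit ϱ τ ρ d mk w then cap w else 0) ⊆ ↑u
        from ?_)]
    · refine Finset.sum_congr rfl fun r hr => ?_
      rw [hu, Finset.mem_image] at hr
      obtain ⟨w₀, hw₀, hrw⟩ := hr
      exact if_pos (hrw ▸ hdom w₀ hw₀)
    · intro w hw
      rw [Function.mem_support] at hw
      have hdw : IsDominantK unit ϱ τ ρ d mk w := by
        by_contra hc'
        exact hw (if_neg hc')
      obtain ⟨hwt, hfx⟩ := hfix w hdw
      rw [Finset.mem_coe, hu, Finset.mem_image]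
      exact ⟨w, hwt, hfx⟩
  rw [hL, hfib, hRHS]
  exact Finset.sum_le_sum hfib_le

/-- ★★ **DOMINATION OF THE LOAD (PROVED)**: under the domino law at `x`, `ballLoad(x) ≤ domLoadK(x)`. -/
theorem dl_ballLoad_le_domLoadK {s R_N unit r_f dK dstar κ c_T cχ τ ϱ r₁ r₂ : ℝ} {P : PeriodicConfiguration 3} {C X : Set E3} {c₀ : E3}
    {f : Fin 3 → E3} {ρ : ℝ} (h1 : IsSeparatedRef s P) (hs : 0 < s) (hf : Orthonormal ℝ f) (hρ : 0 < ρ)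
    (hCF : IsCubicFrameOf P r₁ r₂ c₀ f ρ) (x : E3)
    (hlaw : ∀ w : Fin 3 → ℤ,
      IsDominantK unit ϱ τ ρ (latDepth C c₀ f ρ) (IsMarked ϱχ D σ R_N r_f dK dstar κ c_T cχ P C X τ ϱ r₁ r₂ c₀ f ρ x) w →
      domSum ϱχ D σ R_N r_f dK dstar κ c_T cχ P C X τ ϱ r₁ r₂ c₀ f ρ x w ≤ domCapK unit ϱ τ ρ (chargeDepth ρ (latDepth C c₀ f ρ) w)) :
    ballLoad ϱχ D σ R_N r_f dK dstar κ c_T cχ P C X τ ϱ r₁ r₂ x ≤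
      domLoadK ϱχ D σ R_N unit r_f dK dstar κ c_T cχ P C X τ ϱ r₁ r₂ c₀ f ρ x := by
  rw [dl_ballLoad_eq_rest_add_line h1 hs x]
  unfold domLoadK
  exact add_le_add le_rfl ((dl_ballLine_le_marked h1 hs hf hρ hCF x).trans
    (dl_marked_le_dominantK (dl_marked_finite h1 hs hf hρ x) (fun w => holeCost_nonneg _ _ _ _ _ _ _ w) fun w hw => hlaw w hw))

/-- ★★ **DOMINATION OF THE MOMENT (PROVED)**: under the domino law on the ball of `y`, `Ξ(y) ≤ Ξ_D(y)` (pools are non-negative). -/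
theorem dl_ballMoment_le_domMomentK {s R_N unit r_f dK dstar κ c_T cχ τ ϱ r₁ r₂ : ℝ} {P : PeriodicConfiguration 3} {C X : Set E3}
    {c₀ : E3} {f : Fin 3 → E3} {ρ : ℝ} (h1 : IsSeparatedRef s P) (hs : 0 < s) (hf : Orthonormal ℝ f) (hρ : 0 < ρ)
    (hCF : IsCubicFrameOf P r₁ r₂ c₀ f ρ) (y : E3)
    (hlaw : ∀ x : E3, x ∈ P.points → dist x y ≤ R_N → ∀ w : Fin 3 → ℤ,
      IsDominantK unit ϱ τ ρ (latDepth C c₀ f ρ) (IsMarked ϱχ D σ R_N r_f dK dstar κ c_T cχ P C X τ ϱ r₁ r₂ c₀ f ρ x) w →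
      domSum ϱχ D σ R_N r_f dK dstar κ c_T cχ P C X τ ϱ r₁ r₂ c₀ f ρ x w ≤ domCapK unit ϱ τ ρ (chargeDepth ρ (latDepth C c₀ f ρ) w)) :
    ballMoment ϱχ D σ R_N r_f dK dstar κ c_T cχ P C X τ ϱ r₁ r₂ y ≤
      domMomentK ϱχ D σ R_N unit r_f dK dstar κ c_T cχ P C X τ ϱ r₁ r₂ c₀ f ρ y := by
  unfold ballMoment domMomentK
  set B := (h1.finite_inter_closedBall hs y R_N).toFinset with hB
  have hsupp : ∀ g : E3 → ℝ, Function.support (fun x : E3 => if x ∈ P.points ∧ dist x y ≤ R_N then g x else 0) ⊆ ↑B := by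
    intro g x hx
    rw [Function.mem_support] at hx
    rw [hB, Set.Finite.coe_toFinset]
    by_contra hc
    refine hx (if_neg fun hb => hc ⟨hb.1, ?_⟩)
    rw [Metric.mem_closedBall]
    exact hb.2
  refine fz_finsum_le B (hsupp fun x => pool ϱχ D σ r_f dK dstar κ c_T cχ P C X τ ϱ r₁ r₂ x *
      ballLoad ϱχ D σ R_N r_f dK dstar κ c_T cχ P C X τ ϱ r₁ r₂ x)
    (hsupp fun x => pool ϱχ D σ r_f dK dstar κ c_T cχ P C X τ ϱ r₁ r₂ x *
      domLoadK ϱχ D σ R_N unit r_f dK dstar κ c_T cχ P C X τ ϱ r₁ r₂ c₀ f ρ x) fun x _ => ?_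
  by_cases hc : x ∈ P.points ∧ dist x y ≤ R_N
  · rw [if_pos hc, if_pos hc]
    exact mul_le_mul_of_nonneg_left (dl_ballLoad_le_domLoadK h1 hs hf hρ hCF x (hlaw x hc.1 hc.2))
      (pool_nonneg r_f dK dstar κ c_T cχ P C X τ ϱ r₁ r₂ x)
  · rw [if_neg hc, if_neg hc]

/-- ★★★ **GLUE OF NODE 89 (PROVED)**: (DL) ∧ (DT) ⟹ (M¹) `BallMatchingSingleQ'`, for any class and constants with `0 < s`, `0 < ρlo`. -/
theorem ballMatchingSingleQ'_of_dominoLedgerK {cls : Set E3 → Prop} {R_N r_f dK dstar κ c_T cχ unit s lam ℓ τ ϱ ϱχ r₁ r₂ ρlo ρhi : ℝ}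
    (hs : 0 < s) (hlo : 0 < ρlo)
    (hL : DominoLawQ'K cls R_N r_f dK dstar κ c_T cχ unit s lam ℓ τ ϱ ϱχ r₁ r₂ ρlo ρhi)
    (hM : DominoMatchingQ'K cls R_N r_f dK dstar κ c_T cχ unit s lam ℓ τ ϱ ϱχ r₁ r₂ ρlo ρhi) :
    BallMatchingSingleQ' cls R_N r_f dK dstar κ c_T cχ s lam ℓ τ ϱ ϱχ r₁ r₂ ρlo ρhi := by
  intro P C X m D σ h1 h2 hcl h3 h4 h6 h7 h11 hcv hFr c₀ f ρ hf hρ1 hρ2 hCF y z hH hT hsc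
  obtain ⟨hPos, hMom⟩ := hM P C X m D σ h1 h2 hcl h3 h4 h6 h7 h11 hcv hFr c₀ f ρ hf hρ1 hρ2 hCF y z hH hT hsc
  exact ⟨hPos, (dl_ballMoment_le_domMomentK h1 hs hf (hlo.trans_le hρ1) hCF y
    (hL P C X m D σ h1 h2 hcl h3 h4 h6 h7 h11 hcv hFr c₀ f ρ hf hρ1 hρ2 hCF y z hH hT hsc)).trans hMom⟩

end Glue89K

/-! ## §K5. Designation and the cone onto 14231 at the κ cap (twins of `…DominoLedger`) -/

section Designate89K

/-- ★★★ **NODE 89 AT THE DESIGNATE (PROVED)**: (DL) ∧ (DT) ⟹ (M¹) `BallMatchingSingleQ' cls₀ 80 … (691/1000)` (`unit = c_T = 1/60000000`). -/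
theorem ballMatchingSingleQ'_designate_of_dominoLedgerK
    (hDL : DominoLawQ'K cls₀ 80 20 130 106 (1 / 3600000000) (1 / 60000000) (1 / 2000000) (1 / 60000000) (3 / 5) (1 / 3) 3 (3 / 100) 160 80
      (6 / 5) (3 / 2) (679 / 1000) (691 / 1000))
    (hDT : DominoMatchingQ'K cls₀ 80 20 130 106 (1 / 3600000000) (1 / 60000000) (1 / 2000000) (1 / 60000000) (3 / 5) (1 / 3) 3 (3 / 100) 160
      80 (6 / 5) (3 / 2) (679 / 1000) (691 / 1000)) :
    BallMatchingSingleQ' cls₀ 80 20 130 106 (1 / 3600000000) (1 / 60000000) (1 / 2000000) (3 / 5) (1 / 3) 3 (3 / 100) 160 80 (6 / 5)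
      (3 / 2) (679 / 1000) (691 / 1000) :=
  ballMatchingSingleQ'_of_dominoLedgerK (by norm_num) (by norm_num) hDL hDT

/-- ★★ **NODE 89's LEAVES GIVE NODE 88's (PROVED, by name)**: `hDL`, `hDT` and the multi-crossing leaf `hB2` give NODE 88's `hB1 ∧ hB2`. -/
theorem thawSplit_leaves_of_dominoLedger_leavesK
    (hDL : DominoLawQ'K cls₀ 80 20 130 106 (1 / 3600000000) (1 / 60000000) (1 / 2000000) (1 / 60000000) (3 / 5) (1 / 3) 3 (3 / 100) 160 80
      (6 / 5) (3 / 2) (679 / 1000) (691 / 1000))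
    (hDT : DominoMatchingQ'K cls₀ 80 20 130 106 (1 / 3600000000) (1 / 60000000) (1 / 2000000) (1 / 60000000) (3 / 5) (1 / 3) 3 (3 / 100) 160
      80 (6 / 5) (3 / 2) (679 / 1000) (691 / 1000))
    (hB2 : BallMatchingMultiQ' cls₀ 80 20 130 106 (1 / 3600000000) (1 / 60000000) (1 / 2000000) (3 / 5) (1 / 3) 3 (3 / 100) 160 80 (6 / 5)
      (3 / 2) (679 / 1000) (691 / 1000)) :
    BallMatchingSingleQ' cls₀ 80 20 130 106 (1 / 3600000000) (1 / 60000000) (1 / 2000000) (3 / 5) (1 / 3) 3 (3 / 100) 160 80 (6 / 5)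
        (3 / 2) (679 / 1000) (691 / 1000) ∧
      BallMatchingMultiQ' cls₀ 80 20 130 106 (1 / 3600000000) (1 / 60000000) (1 / 2000000) (3 / 5) (1 / 3) 3 (3 / 100) 160 80 (6 / 5)
        (3 / 2) (679 / 1000) (691 / 1000) :=
  ⟨ballMatchingSingleQ'_designate_of_dominoLedgerK hDL hDT, hB2⟩

/-- ★★★ **THE CONE AFTER NODE 89**: `ChargedEnergyGap` from NODE 88's cone `chargedEnergyGap_of_thawSplit_numerics` with
`hB1 ↦ ballMatchingSingleQ'_designate_of_dominoLedgerK hDL hDT` — 33 hypotheses: NODE 88's 32 binders VERBATIM with `hB1` replaced by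
`hDL : DominoLawQ'K …` (DL) and `hDT : DominoMatchingQ'K …` (DT); the residual-deciding binder of the lane is `hDT`, the local law is `hDL`
(`hB2` is discharged by name: pass `ballMatchingMultiQ'_designate_of_lineMulti hKC hMM`). -/
theorem chargedEnergyGap_of_dominoLedger_numericsK {b₁ : ℝ} (hb : 1 / 8 ≤ b₁) (hU : Fcc.FccScaleNumerics) (hF : ChargeRecount)
    (hIP : ImprovablePricingG (3 / 20) (1 / 10) (6 / 5) 10 (1 / 100) (3 / 5))
    (hFCP : FrustratedCorePricingG (3 / 20) (1 / 10) (6 / 5) 10 (1 / 100) 40 (3 / 5))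
    (hCCP : CoherentCorePricingG (3 / 20) (1 / 10) (6 / 5) 10 (1 / 100) 40 (1 / 10) 40 (3 / 5))
    (hB : CoreBallRegularPricingW (maxCoverWeights (3 / 20) (1 / 10) (6 / 5) 10 (1 / 100) 40 (1 / 10) 40 160) (1 / 20) (3 / 5) 10
      fun _ _ => True)
    (hLab : CleanLabellingW (maxCoverWeights (3 / 20) (1 / 10) (6 / 5) 10 (1 / 100) 40 (1 / 10) 40 160) (3 / 5) 10 (1 / 3) 3)
    (hSB : ShellBudgetW (maxCoverWeights (3 / 20) (1 / 10) (6 / 5) 10 (1 / 100) 40 (1 / 10) 40 160) (3 / 5) 100000)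
    (hLf : LoadBoundQ IsFccImage (3 / 5) (1 / 3) 3 (1 / 100) (3 / 100) 160 (2 / 5) 3 b₁ 80 (6 / 5) (3 / 4) (3 / 10000000) (9 / 1000000))
    (hNf : NnStiffCls IsFccImage (27 / 10) (6 / 5))
    (hOL : OctLedgerQ (IsCubicFccImage (1921 / 2000) (977 / 1000)) (3 / 5) (1 / 3) 3 (1 / 100) (3 / 100) 160 (2 / 5) 3 b₁ 80 (6 / 5) (3 / 2)
      (1 / 2) (679 / 1000) (691 / 1000))
    (hA : A0Plus)
    (hT : RoofTableQ (471 / 1000) T75)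
    (hZ : SixFeetZeroConeQ (679 / 1000) (691 / 1000) 20 106 160)
    (hCap : SixFeetShallowCapQ (679 / 1000) (691 / 1000) 20 106 160 (3 / 100) (1 / 3600000000))
    (hI : SVertexIncidenceQ cls₀ 20 106 36 (3 / 5) (1 / 3) 3 160 80 (6 / 5) (3 / 2))
    (hZK : SixFeetZeroConeQ (679 / 1000) (691 / 1000) 330 130 160)
    (hSF : BallSupportQ 80 20 130 106 (1 / 3600000000) (1 / 60000000) (1 / 2000000) (3 / 5) (3 / 100) 160 80 (6 / 5) (3 / 2))
    (hDL : DominoLawQ'K cls₀ 80 20 130 106 (1 / 3600000000) (1 / 60000000) (1 / 2000000) (1 / 60000000) (3 / 5) (1 / 3) 3 (3 / 100) 160 80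
      (6 / 5) (3 / 2) (679 / 1000) (691 / 1000))
    (hDT : DominoMatchingQ'K cls₀ 80 20 130 106 (1 / 3600000000) (1 / 60000000) (1 / 2000000) (1 / 60000000) (3 / 5) (1 / 3) 3 (3 / 100) 160
      80 (6 / 5) (3 / 2) (679 / 1000) (691 / 1000))
    (hB2 : BallMatchingMultiQ' cls₀ 80 20 130 106 (1 / 3600000000) (1 / 60000000) (1 / 2000000) (3 / 5) (1 / 3) 3 (3 / 100) 160 80 (6 / 5)
      (3 / 2) (679 / 1000) (691 / 1000))
    (hPD : BandBallQ' cls₀ 80 20 130 106 (1 / 3600000000) (1 / 60000000) (1 / 2000000) (3 / 5) (1 / 3) 3 (3 / 100) 160 80 (6 / 5)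
      (3 / 2) (679 / 1000) (691 / 1000))
    (hNP : BallIncidenceQ' cls₀ 80 20 130 106 (1 / 3600000000) (1 / 60000000) (1 / 2000000) (3 / 5) (1 / 3) 3 (3 / 100) 160 80 (6 / 5)
      (3 / 2) (679 / 1000) (691 / 1000))
    (hFf : FarTrussQ IsFccImage (3 / 5) (1 / 3) 3 (1 / 100) (3 / 100) 160 (2 / 5) 3 b₁ 80 (6 / 5) (3 / 2) (11 / 20) (1 / 25) (1 / 60000000)
      (1 / 2000000))
    (hGf : GeoExchQ IsFccImage (3 / 5) (1 / 3) 3 (1 / 100) (3 / 100) 160 (2 / 5) 3 b₁ 80 (6 / 5) (3 / 20) (1 / 25) (1 / 30000000) (1 / 1000000))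
    (hLh : LoadBoundQ IsHcpImage (3 / 5) (1 / 3) 3 (1 / 100) (3 / 100) 160 (2 / 5) 3 b₁ 80 (6 / 5) (3 / 4) (3 / 10000000) (9 / 1000000))
    (hNh : NnStiffCls IsHcpImage (27 / 10) (6 / 5))
    (hMh : MidTrussQ IsHcpImage (3 / 5) (1 / 3) 3 (1 / 100) (3 / 100) 160 (2 / 5) 3 b₁ 80 (6 / 5) (3 / 2) (1 / 2) 0 (1 / 60000000) (1 / 2000000))
    (hFh : FarTrussQ IsHcpImage (3 / 5) (1 / 3) 3 (1 / 100) (3 / 100) 160 (2 / 5) 3 b₁ 80 (6 / 5) (3 / 2) (1 / 2) (1 / 40) (1 / 60000000)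
      (1 / 2000000))
    (hGh : GeoExchQ IsHcpImage (3 / 5) (1 / 3) 3 (1 / 100) (3 / 100) 160 (2 / 5) 3 b₁ 80 (6 / 5) (1 / 5) (1 / 40) (1 / 30000000) (1 / 1000000))
    (hN : LocalSeamReductionQ' (3 / 5) (1 / 3) 3 (1 / 100) (3 / 100) (1 / 2) 160 (2 / 5) 3 b₁ 80 (1 / 3000000) (1 / 100000)
      (maxCoverWeights (3 / 20) (1 / 10) (6 / 5) 10 (1 / 100) 40 (1 / 10) 40 160) (1 / 20) 10 100000)
    (hP : ChartedChargePricingG (3 / 20) (1 / 10) (3 / 5))  : ChargedEnergyGap :=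
  chargedEnergyGap_of_thawSplit_numerics hb hU hF hIP hFCP hCCP hB hLab hSB hLf hNf hOL hA hT hZ hCap hI hZK hSF
    (ballMatchingSingleQ'_designate_of_dominoLedgerK hDL hDT) hB2 hPD hNP hFf hGf hLh hNh hMh hFh hGh hN hP

end Designate89K

end Summit.AtomisticToContinuum.Crystallization.Theorems.ChargedEnergyGapChartDial

end
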